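import Literature.MathematicalPhysics.KineticTheory.HardSphereCanonicalLabelLaw
import Literature.MathematicalPhysics.KineticTheory.HardSphereUniformGasShift
import Summits.AtomisticToContinuum.HydrodynamicLimit.Theorems.JParityClosureEvenStressEnskogPlateauWindow
import HarnessLib

/-!
# [CL-ρ] statics: one- and two-point estimates of the homogeneous hard-sphere gas for the mesoscopic
# density LLN (line `hemisphere-affine-slaving`, crux `CollisionalTransferLocality`, stmt-AtomisticToContinuum-9518)

Helper file (`--supports stmt-AtomisticToContinuum-9518`) of the registered stub `stub_blockDensityLLNConst`
(the mesoscopic density law of large numbers of the homogeneous gas, landed in the sequel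
`…CollisionalTransferLocalityBlockDensityLLNConst`).  For the configurational canonical Gibbs measure
`P_N = posGibbsMeasure 1 ε_N (N+1)` of `N + 1` hard spheres of diameter `ε_N = σ(N+1)^{-1/3}` on `𝕋³` at small
reduced density (`SmallDensity uniformProfile σ`):

* `vcan_single_eq_one` — the normalised one-point function is IDENTICALLY ONE, `v_{m+1}(y) = 1`
  (translation invariance of the pinned hard-core probability and the transfer recursion);
* `integral_apply_eq_integral` — `E_{P_N}[χ(xᵢ)] = ∫ χ` for continuous `χ` (translation invariance);
* `abs_pairIntegrand_le`, `integral_mul_apply_le` — THE TWO-POINT ESTIMATE: for `i ≠ j` and a continuous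
  kernel `0 ≤ φ ≤ Φ_b` of mass one, `E_{P_N}[φ(xᵢ)φ(xⱼ)] ≤ 1 + 16δ' + 5 Φ_b v₁ (Mε_N)³` given the canonical
  two-cluster factorisation `|v(Y ++ Y') − v(Y) v(Y')| ≤ δ' 4^{k+k'}` at separation `≥ M ε_N`
  (`HardSphereCanonicalTwoClusterLimit.vcan_append_sub_mul_le`, taken as a hypothesis at fixed `N`): by the
  labelled pair law (`integral_pairLabel_eq_integral_mul_vcan`) the expectation is `∫ φ⊗φ · v₂`; far from the
  diagonal `|v₂ − 1| = |v₂ − v₁ ⊗ v₁| ≤ 16 δ'`, near it `|v₂ − 1| ≤ 5` (`abs_vcan_le`) on a region of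
  `φ ⊗ 1`-mass `v₁ (Mε_N)³` (`integral_mul_nearInd`, `Torus.volume_euclidDist_lt`);
* `integral_sq_sub_one_le` — expanding the square, `E_{P_N}[((N+1)⁻¹Σᵢ φ(xᵢ) − 1)²] ≤ Φ_b/(N+1) + B` whenever
  all off-diagonal pair expectations are `≤ 1 + B`.

References: D. Ruelle, *Statistical Mechanics: Rigorous Results* (1969), §4.2 [Ruelle1969]; H. Spohn, *Large
Scale Dynamics of Interacting Particles* (1991), Part I §2.3 [Spohn1991].
-/

namespace Summit.AtomisticToContinuum.HydrodynamicLimit.Theorems.HemisphereAffineSlaving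

open scoped BigOperators Topology Classical ENNReal
open Filter Set Function MeasureTheory

noncomputable section

-- `T3 = UnitAddTorus (Fin 3)`, `V3 = EuclideanSpace ℝ (Fin 3)` (the tree's abbreviations), opened with the
-- exact line of the line's other files.
open Literature.MathematicalPhysics.KineticTheory (T3 V3)

namespace BlockDensityLLNConst

open Literature.MathematicalPhysics.KineticTheory Literature.Analysis.FluidPDE
open Literature.MathematicalPhysics.StatisticalMechanics

/-- **The one-point function of the canonical hard-sphere gas on `𝕋³` is identically one**:
`v_{m+1}(y) = u_ε(y)(m)/Ξ_ε(m+1) = 1` whenever `Ξ_ε(m+1) > 0` — translation invariance of the pinned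
hard-core probability (`pinnedXi_const_add`) and the transfer recursion `Ξ_ε(m+1) = ∫ u_ε(x₀)(m) dx₀`
(`pinnedXi_succ_eq_integral_cons`). [folklore] -/
theorem vcan_single_eq_one (ε : ℝ) {m : ℕ} (hΞ : 0 < XiT ε (m + 1)) (y : T3) :
    vcan ε (m + 1) ![y] = 1 := by
  have hconst : ∀ y : T3, pinnedXi ε ![y] m = pinnedXi ε ![(0 : T3)] m := fun y => by
    have e : (fun a => y + (![(0 : T3)] : Fin 1 → T3) a) = ![y] := by
      funext a; fin_cases a; simp
    rw [← e]
    exact pinnedXi_const_add ε y ![(0 : T3)] m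
  have hX : XiT ε (m + 1) = pinnedXi ε ![(0 : T3)] m := by
    rw [XiT, pinnedXi_succ_eq_integral_cons]
    have e : ∀ x₀ : T3, (Fin.cons x₀ (fun i : Fin 0 => Fin.elim0 i) : Fin 1 → T3) = ![x₀] :=
      fun _ => rfl
    simp_rw [e, hconst]
    rw [integral_const, probReal_univ, one_smul]
  rw [vcan, Nat.add_sub_cancel, hconst, ← hX]
  exact div_self hΞ.ne'

/-- The near-pair indicator `ω ↦ 𝟙{d(g ω, f ω) < r}` is measurable along measurable `f, g`. [folklore] -/
theorem measurable_nearInd {Ω : Type*} [MeasurableSpace Ω] {f g : Ω → T3} (hf : Measurable f)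
    (hg : Measurable g) (r : ℝ) :
    Measurable fun ω => {x : T3 | Torus.euclidDist x (f ω) < r}.indicator (fun _ => (1 : ℝ)) (g ω) := by
  have hd : Measurable fun ω => Torus.euclidDist (g ω) (f ω) := by
    change Measurable fun ω => ‖Torus.reprSym (g ω - f ω)‖
    exact (Torus.measurable_reprSym.comp (hg.sub hf)).norm
  change Measurable fun ω => if Torus.euclidDist (g ω) (f ω) < r then (1 : ℝ) else 0
  exact Measurable.ite (measurableSet_lt hd measurable_const) measurable_const measurable_const

/-- `∫∫ φ(a) 𝟙{d(b, a) < r} da db = v₁ r³ ∫ φ = v₁ r³` for a kernel of mass one and `r < 1/2`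
(translation invariance of Haar measure, `Torus.volume_euclidDist_lt`). [folklore] -/
theorem integral_mul_nearInd {φ : T3 → ℝ} (hφ : Continuous φ) {Φb : ℝ} (hφa : ∀ y, |φ y| ≤ Φb)
    (hφ1 : ∫ y, φ y = 1) {r : ℝ} (hr0 : 0 ≤ r) (hr : r < 1 / 2) :
    ∫ p : Fin 2 → T3, φ (p 0) * {x : T3 | Torus.euclidDist x (p 0) < r}.indicator (fun _ => (1 : ℝ)) (p 1) =
      v₁ * r ^ 3 := by
  rw [EvenStressEnskog.integral_finTwo_eq_iterated
    (fun a b => φ a * {x : T3 | Torus.euclidDist x a < r}.indicator (fun _ => (1 : ℝ)) b) ?_]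
  · have inner : ∀ a : T3, ∫ b : T3, φ a * {x : T3 | Torus.euclidDist x a < r}.indicator
        (fun _ => (1 : ℝ)) b = φ a * (v₁ * r ^ 3) := fun a => by
      -- minimal-image balls are measurable
      have hB : MeasurableSet {x : T3 | Torus.euclidDist x a < r} := by
        have hdist : Measurable fun x : T3 => Torus.euclidDist x a := by
          change Measurable fun x : T3 => ‖Torus.reprSym (x - a)‖
          exact (Torus.measurable_reprSym.comp (measurable_id.sub_const a)).norm
        exact measurableSet_lt hdist measurable_const
      rw [integral_const_mul, integral_indicator_const _ hB, smul_eq_mul, mul_one, measureReal_def,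
        Torus.volume_euclidDist_lt hr a, EvenStressEnskog.volume_real_ball_E3 hr0]
    simp_rw [inner]
    rw [integral_mul_const, hφ1, one_mul]
  · exact Integrable.of_bound ((hφ.measurable.comp measurable_fst).mul
      (measurable_nearInd measurable_fst measurable_snd r)).aestronglyMeasurable (Φb * 1)
      (ae_of_all _ fun p => by
        rw [Real.norm_eq_abs, abs_mul]
        exact mul_le_mul (hφa _) (EvenStressEnskog.abs_indicator_one_le_one _ _) (abs_nonneg _)
          ((abs_nonneg _).trans (hφa p.1)))

variable {σ : ℝ} (h : SmallDensity uniformProfile σ)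
include h

/-- **One-point expectations of the uniform canonical gas are Haar averages**: `E_{P_N}[χ(xᵢ)] = ∫ χ` for
continuous `χ` (translation invariance of `P_N`, `integral_mul_shiftInvariant` with the trivial co-factor).
[folklore] -/
theorem integral_apply_eq_integral (N : ℕ) (i : Fin (N + 1)) {χ : T3 → ℝ} (hχ : Continuous χ) :
    ∫ x, χ (x i) ∂posGibbsMeasure (fun _ : T3 => (1 : ℝ)) (hsDiameter σ N) (N + 1) = ∫ y, χ y := by
  haveI := isProbabilityMeasure_posGibbsMeasure continuous_const (fun _ => one_pos) h.σ_lt_half.le N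
  have key := integral_mul_shiftInvariant 1 (hsDiameter σ N) i hχ (f := fun _ => (1 : ℝ))
    measurable_const (B := 1) (fun _ => by simp) (fun _ _ => rfl)
  simpa using key

/-- `v_{N+1}(y) = 1` along the hydrodynamic scaling at small reduced density (`Ξ > 0`, `XiT_pos`). [folklore] -/
theorem vcan_single_eq_one' (N : ℕ) (y : T3) : vcan (hsDiameter σ N) (N + 1) ![y] = 1 :=
  vcan_single_eq_one _ (XiT_pos h le_rfl) y

/-- **Pointwise bound of the pair integrand** (far: two-cluster factorisation with singleton clusters and
`v₁ ≡ 1`; near: the a priori bound `v ≤ 2^k`). [folklore] -/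
theorem abs_pairIntegrand_le (N : ℕ) {φ : T3 → ℝ} (hφ0 : ∀ y, 0 ≤ φ y) {Φb : ℝ} (hφb : ∀ y, φ y ≤ Φb)
    {M δ' : ℝ} (hδ'0 : 0 ≤ δ')
    (hAN : ∀ (k k' : ℕ) (Y : Fin k → T3) (Y' : Fin k' → T3) (c c' : T3),
        (∀ a, Torus.euclidDist (Y a) c < 1 * hsDiameter σ N) →
        (∀ a, Torus.euclidDist (Y' a) c' < 1 * hsDiameter σ N) →
        M * hsDiameter σ N ≤ Torus.euclidDist c c' →
        |vcan (hsDiameter σ N) (N + 1) (Fin.append Y Y') -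
            vcan (hsDiameter σ N) (N + 1) Y * vcan (hsDiameter σ N) (N + 1) Y'| ≤ δ' * 4 ^ (k + k'))
    (y : Fin 2 → T3) :
    |φ (y 0) * φ (y 1) * vcan (hsDiameter σ N) (N + 1) y - φ (y 0) * φ (y 1)| ≤
      16 * δ' * (φ (y 0) * φ (y 1)) + 5 * Φb * (φ (y 0) *
        {x : T3 | Torus.euclidDist x (y 0) < M * hsDiameter σ N}.indicator (fun _ => (1 : ℝ)) (y 1)) := by
  have hε : 0 < hsDiameter σ N := hsDiameter_pos h.σ_pos N
  have hΦb : 0 ≤ Φb := (hφ0 0).trans (hφb 0)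
  have hnear_0 : 0 ≤ {x : T3 | Torus.euclidDist x (y 0) < M * hsDiameter σ N}.indicator
      (fun _ => (1 : ℝ)) (y 1) := EvenStressEnskog.indicator_one_nonneg _ _
  have happ : Fin.append ![y 0] ![y 1] = y := by
    funext a; fin_cases a <;> rfl
  have hφφ : 0 ≤ φ (y 0) * φ (y 1) := mul_nonneg (hφ0 _) (hφ0 _)
  rw [← mul_sub_one, abs_mul, abs_of_nonneg hφφ]
  by_cases hfar : M * hsDiameter σ N ≤ Torus.euclidDist (y 0) (y 1)
  · have h1 := hAN 1 1 ![y 0] ![y 1] (y 0) (y 1)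
      (fun a => by fin_cases a; simpa using hε) (fun a => by fin_cases a; simpa using hε) hfar
    rw [happ, vcan_single_eq_one' h N, vcan_single_eq_one' h N, mul_one] at h1
    calc φ (y 0) * φ (y 1) * |vcan (hsDiameter σ N) (N + 1) y - 1|
        ≤ φ (y 0) * φ (y 1) * (δ' * 4 ^ (1 + 1)) := mul_le_mul_of_nonneg_left h1 hφφ
      _ = 16 * δ' * (φ (y 0) * φ (y 1)) := by ring
      _ ≤ _ := le_add_of_nonneg_right (mul_nonneg (mul_nonneg (by norm_num) hΦb)
          (mul_nonneg (hφ0 _) hnear_0))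
  · have hmem : y 1 ∈ {x : T3 | Torus.euclidDist x (y 0) < M * hsDiameter σ N} := by
      rw [mem_setOf_eq, Torus.euclidDist_comm]; exact lt_of_not_ge hfar
    rw [indicator_of_mem hmem]
    have hv : |vcan (hsDiameter σ N) (N + 1) y - 1| ≤ 5 := by
      calc |vcan (hsDiameter σ N) (N + 1) y - 1| ≤ |vcan (hsDiameter σ N) (N + 1) y| + |(1 : ℝ)| :=
            abs_sub _ _
        _ ≤ 2 ^ 2 + 1 := add_le_add (abs_vcan_le h le_rfl y) (by norm_num)
        _ = 5 := by norm_num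
    calc φ (y 0) * φ (y 1) * |vcan (hsDiameter σ N) (N + 1) y - 1| ≤ φ (y 0) * Φb * 5 :=
          mul_le_mul (mul_le_mul_of_nonneg_left (hφb _) (hφ0 _)) hv (abs_nonneg _)
            (mul_nonneg (hφ0 _) hΦb)
      _ = 5 * Φb * (φ (y 0) * 1) := by ring
      _ ≤ _ := le_add_of_nonneg_left (mul_nonneg (mul_nonneg (by norm_num) hδ'0) hφφ)


/-- **The two-point estimate.**  For `i ≠ j`, a continuous kernel `0 ≤ φ ≤ Φ_b` of mass one, and the
two-cluster factorisation of `v = vcan ε_N (N+1)` at window `1`, accuracy `δ'`, separation `M` with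
`M ε_N < 1/2`:  `E_{P_N}[φ(xᵢ) φ(xⱼ)] ≤ 1 + 16 δ' + 5 Φ_b v₁ (M ε_N)³`.  By the labelled pair law the left
side is `∫ φ ⊗ φ · v`, `∫ φ ⊗ φ = 1`, and the pointwise bound `abs_pairIntegrand_le` integrates (near region:
`integral_mul_nearInd`). [cite: Ruelle1969, §4.2.3 Thm 4.2.3] -/
theorem integral_mul_apply_le (N : ℕ) {i j : Fin (N + 1)} (hij : i ≠ j) {φ : T3 → ℝ}
    (hφ : Continuous φ) (hφ0 : ∀ y, 0 ≤ φ y) {Φb : ℝ} (hφb : ∀ y, φ y ≤ Φb) (hφ1 : ∫ y, φ y = 1)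
    {M δ' : ℝ} (hM : 0 ≤ M) (hδ'0 : 0 ≤ δ') (hMε : M * hsDiameter σ N < 1 / 2)
    (hAN : ∀ (k k' : ℕ) (Y : Fin k → T3) (Y' : Fin k' → T3) (c c' : T3),
        (∀ a, Torus.euclidDist (Y a) c < 1 * hsDiameter σ N) →
        (∀ a, Torus.euclidDist (Y' a) c' < 1 * hsDiameter σ N) →
        M * hsDiameter σ N ≤ Torus.euclidDist c c' →
        |vcan (hsDiameter σ N) (N + 1) (Fin.append Y Y') -
            vcan (hsDiameter σ N) (N + 1) Y * vcan (hsDiameter σ N) (N + 1) Y'| ≤ δ' * 4 ^ (k + k')) :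
    ∫ x, φ (x i) * φ (x j) ∂posGibbsMeasure (fun _ : T3 => (1 : ℝ)) (hsDiameter σ N) (N + 1) ≤
      1 + 16 * δ' + 5 * Φb * (v₁ * (M * hsDiameter σ N) ^ 3) := by
  have hε : 0 < hsDiameter σ N := hsDiameter_pos h.σ_pos N
  have hΦb : 0 ≤ Φb := (hφ0 0).trans (hφb 0)
  have hφa : ∀ y, |φ y| ≤ Φb := fun y => by rw [abs_of_nonneg (hφ0 y)]; exact hφb y
  have hφm : Measurable φ := hφ.measurable
  have hint : ∀ {g : (Fin 2 → T3) → ℝ}, Measurable g → ∀ K : ℝ, (∀ p, |g p| ≤ K) →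
      Integrable g (volume : Measure (Fin 2 → T3)) := fun hg K hK =>
    Integrable.of_bound hg.aestronglyMeasurable K (ae_of_all _ fun p => by rw [Real.norm_eq_abs]; exact hK p)
  -- the pair law
  have hFm : Measurable fun y : Fin 2 → T3 => φ (y 0) * φ (y 1) :=
    (hφm.comp (measurable_pi_apply 0)).mul (hφm.comp (measurable_pi_apply 1))
  have hFb : ∀ y : Fin 2 → T3, |φ (y 0) * φ (y 1)| ≤ Φb * Φb := fun y => by
    rw [abs_mul]; exact mul_le_mul (hφa _) (hφa _) (abs_nonneg _) hΦb
  have e2 : ∫ x, φ (x i) * φ (x j) ∂posGibbsMeasure (fun _ : T3 => (1 : ℝ)) (hsDiameter σ N) (N + 1) =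
      ∫ y : Fin 2 → T3, φ (y 0) * φ (y 1) * vcan (hsDiameter σ N) (N + 1) y := by
    have := integral_pairLabel_eq_integral_mul_vcan (hsDiameter σ N) hij hFm ⟨_, hFb⟩
    simpa only [Matrix.cons_val_zero, Matrix.cons_val_one, Matrix.head_cons] using this
  -- `∫ φ ⊗ φ = 1`
  have e1 : ∫ y : Fin 2 → T3, φ (y 0) * φ (y 1) = 1 := by
    have := integral_fintype_prod_volume_eq_pow (ι := Fin 2) φ
    simp only [Fin.prod_univ_two, Fintype.card_fin, hφ1, one_pow] at this
    exact this
  -- the near-pair indicator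
  have hnear_m : Measurable fun y : Fin 2 → T3 =>
      {x : T3 | Torus.euclidDist x (y 0) < M * hsDiameter σ N}.indicator (fun _ => (1 : ℝ)) (y 1) :=
    measurable_nearInd (measurable_pi_apply 0) (measurable_pi_apply 1) _
  -- integrability
  have hvm : Measurable fun y : Fin 2 → T3 => vcan (hsDiameter σ N) (N + 1) y :=
    measurable_vcan_comp _ _ measurable_id
  have hI1 : Integrable (fun y : Fin 2 → T3 => φ (y 0) * φ (y 1) * vcan (hsDiameter σ N) (N + 1) y) :=
    hint (hFm.mul hvm) (Φb * Φb * 2 ^ 2) fun y => by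
      rw [abs_mul]; exact mul_le_mul (hFb y) (abs_vcan_le h le_rfl y) (abs_nonneg _) (by positivity)
  have hI2 : Integrable (fun y : Fin 2 → T3 => φ (y 0) * φ (y 1)) := hint hFm (Φb * Φb) hFb
  have hI3 : Integrable (fun y : Fin 2 → T3 => φ (y 0) *
      {x : T3 | Torus.euclidDist x (y 0) < M * hsDiameter σ N}.indicator (fun _ => (1 : ℝ)) (y 1)) :=
    hint ((hφm.comp (measurable_pi_apply 0)).mul hnear_m) (Φb * 1) fun y => by
      rw [abs_mul]
      exact mul_le_mul (hφa _) (EvenStressEnskog.abs_indicator_one_le_one _ _) (abs_nonneg _) hΦb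
  have e3 : ∫ y : Fin 2 → T3, φ (y 0) *
      {x : T3 | Torus.euclidDist x (y 0) < M * hsDiameter σ N}.indicator (fun _ => (1 : ℝ)) (y 1) =
        v₁ * (M * hsDiameter σ N) ^ 3 :=
    integral_mul_nearInd hφ hφa hφ1 (by positivity) hMε
  have emaj : ∫ y : Fin 2 → T3, (16 * δ' * (φ (y 0) * φ (y 1)) + 5 * Φb * (φ (y 0) *
      {x : T3 | Torus.euclidDist x (y 0) < M * hsDiameter σ N}.indicator (fun _ => (1 : ℝ)) (y 1))) =
      16 * δ' + 5 * Φb * (v₁ * (M * hsDiameter σ N) ^ 3) := by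
    rw [integral_add (hI2.const_mul _) (hI3.const_mul _), integral_const_mul, integral_const_mul, e1,
      e3, mul_one]
  have key : |(∫ y : Fin 2 → T3, φ (y 0) * φ (y 1) * vcan (hsDiameter σ N) (N + 1) y) -
      ∫ y : Fin 2 → T3, φ (y 0) * φ (y 1)| ≤ 16 * δ' + 5 * Φb * (v₁ * (M * hsDiameter σ N) ^ 3) := by
    rw [← integral_sub hI1 hI2, ← emaj, ← Real.norm_eq_abs]
    exact norm_integral_le_of_norm_le ((hI2.const_mul _).add (hI3.const_mul _))
      (ae_of_all _ fun y => by
        rw [Real.norm_eq_abs]; exact abs_pairIntegrand_le h N hφ0 hφb hδ'0 hAN y)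
  rw [e1] at key
  rw [e2]
  linarith [(abs_le.1 key).2]

/-- **The mean square deviation of the block density at a point**:
`E_{P_N}[((N+1)⁻¹ Σᵢ φ(xᵢ) − 1)²] ≤ Φ_b/(N+1) + B` when `0 ≤ φ ≤ Φ_b`, `∫ φ = 1` and every off-diagonal
pair expectation is `≤ 1 + B` (expand the square; one-point expectations are `∫ φ = 1`, diagonal terms
are `≤ Φ_b`). [folklore] -/
theorem integral_sq_sub_one_le (N : ℕ) {φ : T3 → ℝ} (hφ : Continuous φ) (hφ0 : ∀ y, 0 ≤ φ y)
    {Φb : ℝ} (hφb : ∀ y, φ y ≤ Φb) (hφ1 : ∫ y, φ y = 1) {B : ℝ} (hB : 0 ≤ B)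
    (h2 : ∀ i j : Fin (N + 1), i ≠ j →
      ∫ x, φ (x i) * φ (x j) ∂posGibbsMeasure (fun _ : T3 => (1 : ℝ)) (hsDiameter σ N) (N + 1) ≤ 1 + B) :
    ∫ x, (((N + 1 : ℕ) : ℝ)⁻¹ * ∑ i, φ (x i) - 1) ^ 2
        ∂posGibbsMeasure (fun _ : T3 => (1 : ℝ)) (hsDiameter σ N) (N + 1) ≤
      Φb / ((N + 1 : ℕ) : ℝ) + B := by
  haveI := isProbabilityMeasure_posGibbsMeasure continuous_const (fun _ => one_pos) h.σ_lt_half.le N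
  have hn0 : (0 : ℝ) < ((N + 1 : ℕ) : ℝ) := by positivity
  have hΦb : 0 ≤ Φb := (hφ0 0).trans (hφb 0)
  have hφa : ∀ y, |φ y| ≤ Φb := fun y => by rw [abs_of_nonneg (hφ0 y)]; exact hφb y
  have hφm : Measurable φ := hφ.measurable
  have hint : ∀ {g : (Fin (N + 1) → T3) → ℝ}, Measurable g → ∀ K : ℝ, (∀ p, |g p| ≤ K) →
      Integrable g (posGibbsMeasure (fun _ : T3 => (1 : ℝ)) (hsDiameter σ N) (N + 1)) := fun hg K hK =>
    Integrable.of_bound hg.aestronglyMeasurable K (ae_of_all _ fun p => by rw [Real.norm_eq_abs]; exact hK p)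
  have hIi : ∀ i, Integrable (fun x : Fin (N + 1) → T3 => φ (x i))
      (posGibbsMeasure (fun _ : T3 => (1 : ℝ)) (hsDiameter σ N) (N + 1)) := fun i =>
    hint (hφm.comp (measurable_pi_apply i)) Φb fun x => hφa _
  have hIij : ∀ i j, Integrable (fun x : Fin (N + 1) → T3 => φ (x i) * φ (x j))
      (posGibbsMeasure (fun _ : T3 => (1 : ℝ)) (hsDiameter σ N) (N + 1)) := fun i j =>
    hint ((hφm.comp (measurable_pi_apply i)).mul (hφm.comp (measurable_pi_apply j))) (Φb * Φb) fun x => by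
      rw [abs_mul]; exact mul_le_mul (hφa _) (hφa _) (abs_nonneg _) hΦb
  -- one-point expectations
  have e1 : ∀ i, ∫ x, φ (x i) ∂posGibbsMeasure (fun _ : T3 => (1 : ℝ)) (hsDiameter σ N) (N + 1) = 1 :=
    fun i => by rw [integral_apply_eq_integral h N i hφ, hφ1]
  -- all pair expectations
  have eij : ∀ i j,
      ∫ x, φ (x i) * φ (x j) ∂posGibbsMeasure (fun _ : T3 => (1 : ℝ)) (hsDiameter σ N) (N + 1) ≤
        (if i = j then Φb else 0) + (1 + B) := by
    intro i j
    by_cases hij : i = j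
    · subst hij
      rw [if_pos rfl]
      calc ∫ x, φ (x i) * φ (x i) ∂posGibbsMeasure (fun _ : T3 => (1 : ℝ)) (hsDiameter σ N) (N + 1)
          ≤ ∫ x, Φb * φ (x i) ∂posGibbsMeasure (fun _ : T3 => (1 : ℝ)) (hsDiameter σ N) (N + 1) :=
            integral_mono (hIij i i) ((hIi i).const_mul Φb) fun x =>
              mul_le_mul_of_nonneg_right (hφb _) (hφ0 _)
        _ = Φb := by rw [integral_const_mul, e1, mul_one]
        _ ≤ Φb + (1 + B) := le_add_of_nonneg_right (by positivity)
    · rw [if_neg hij, zero_add]; exact h2 i j hij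
  -- the mean and the second moment of `S = (N+1)⁻¹ Σᵢ φ(xᵢ)`
  have hS : ∫ x, ((N + 1 : ℕ) : ℝ)⁻¹ * ∑ i, φ (x i)
      ∂posGibbsMeasure (fun _ : T3 => (1 : ℝ)) (hsDiameter σ N) (N + 1) = 1 := by
    rw [integral_const_mul, integral_finsetSum _ fun i _ => hIi i]
    simp_rw [e1]
    rw [Finset.sum_const, Finset.card_univ, Fintype.card_fin, nsmul_eq_mul, mul_one,
      inv_mul_cancel₀ hn0.ne']
  have hexp : ∀ x : Fin (N + 1) → T3, (((N + 1 : ℕ) : ℝ)⁻¹ * ∑ i, φ (x i)) ^ 2 =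
      ((N + 1 : ℕ) : ℝ)⁻¹ ^ 2 * ∑ i, ∑ j, φ (x i) * φ (x j) := by
    intro x; rw [mul_pow, sq (∑ i, φ (x i)), Finset.sum_mul_sum]
  have hS2int : Integrable (fun x : Fin (N + 1) → T3 => (((N + 1 : ℕ) : ℝ)⁻¹ * ∑ i, φ (x i)) ^ 2)
      (posGibbsMeasure (fun _ : T3 => (1 : ℝ)) (hsDiameter σ N) (N + 1)) := by
    simp_rw [hexp]
    exact (integrable_finsetSum _ fun i _ => integrable_finsetSum _ fun j _ => hIij i j).const_mul _
  have hS2 : ∫ x, (((N + 1 : ℕ) : ℝ)⁻¹ * ∑ i, φ (x i)) ^ 2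
      ∂posGibbsMeasure (fun _ : T3 => (1 : ℝ)) (hsDiameter σ N) (N + 1) ≤
        Φb / ((N + 1 : ℕ) : ℝ) + (1 + B) := by
    simp_rw [hexp]
    rw [integral_const_mul, integral_finsetSum _ fun i _ => integrable_finsetSum _ fun j _ => hIij i j]
    have hin : ∀ i,
        ∫ x, ∑ j, φ (x i) * φ (x j) ∂posGibbsMeasure (fun _ : T3 => (1 : ℝ)) (hsDiameter σ N) (N + 1) ≤
          Φb + ((N + 1 : ℕ) : ℝ) * (1 + B) := by
      intro i
      rw [integral_finsetSum _ fun j _ => hIij i j]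
      calc ∑ j, ∫ x, φ (x i) * φ (x j) ∂posGibbsMeasure (fun _ : T3 => (1 : ℝ)) (hsDiameter σ N) (N + 1)
          ≤ ∑ j, ((if i = j then Φb else 0) + (1 + B)) := Finset.sum_le_sum fun j _ => eij i j
        _ = Φb + ((N + 1 : ℕ) : ℝ) * (1 + B) := by
            rw [Finset.sum_add_distrib, Finset.sum_ite_eq, if_pos (Finset.mem_univ _), Finset.sum_const,
              Finset.card_univ, Fintype.card_fin, nsmul_eq_mul]
    calc ((N + 1 : ℕ) : ℝ)⁻¹ ^ 2 * ∑ i, ∫ x, ∑ j, φ (x i) * φ (x j)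
          ∂posGibbsMeasure (fun _ : T3 => (1 : ℝ)) (hsDiameter σ N) (N + 1)
        ≤ ((N + 1 : ℕ) : ℝ)⁻¹ ^ 2 * ∑ _i : Fin (N + 1), (Φb + ((N + 1 : ℕ) : ℝ) * (1 + B)) :=
          mul_le_mul_of_nonneg_left (Finset.sum_le_sum fun i _ => hin i) (by positivity)
      _ = Φb / ((N + 1 : ℕ) : ℝ) + (1 + B) := by
          rw [Finset.sum_const, Finset.card_univ, Fintype.card_fin, nsmul_eq_mul]
          field_simp
  -- `(S − 1)² = S² − 2S + 1`
  have hSint : Integrable (fun x : Fin (N + 1) → T3 => ((N + 1 : ℕ) : ℝ)⁻¹ * ∑ i, φ (x i))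
      (posGibbsMeasure (fun _ : T3 => (1 : ℝ)) (hsDiameter σ N) (N + 1)) :=
    (integrable_finsetSum _ fun i _ => hIi i).const_mul _
  have hI4 : Integrable (fun x : Fin (N + 1) → T3 =>
      (((N + 1 : ℕ) : ℝ)⁻¹ * ∑ i, φ (x i)) ^ 2 - 2 * (((N + 1 : ℕ) : ℝ)⁻¹ * ∑ i, φ (x i)))
      (posGibbsMeasure (fun _ : T3 => (1 : ℝ)) (hsDiameter σ N) (N + 1)) := hS2int.sub (hSint.const_mul 2)
  have hexp2 : ∀ x : Fin (N + 1) → T3, (((N + 1 : ℕ) : ℝ)⁻¹ * ∑ i, φ (x i) - 1) ^ 2 =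
      ((((N + 1 : ℕ) : ℝ)⁻¹ * ∑ i, φ (x i)) ^ 2 - 2 * (((N + 1 : ℕ) : ℝ)⁻¹ * ∑ i, φ (x i))) + 1 :=
    fun x => by ring
  simp_rw [hexp2]
  rw [integral_add hI4 (integrable_const _), integral_sub hS2int (hSint.const_mul 2), integral_const_mul,
    hS, integral_const, probReal_univ, one_smul]
  linarith [hS2]


end BlockDensityLLNConst

/-- **Registered helper stub `blockDensity_pairExpectation_le`** (sub-goal of `stub_blockDensityLLNConst`, [CL-ρ],
line `hemisphere-affine-slaving`, crux stmt-AtomisticToContinuum-9518): THE TWO-POINT ESTIMATE of the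
homogeneous hard-sphere gas at small reduced density — for `i ≠ j`, a continuous kernel `0 ≤ φ ≤ Φ_b` of mass
one on `𝕋³`, and the canonical two-cluster factorisation of `v = vcan ε_N (N+1)` at window `1`, accuracy `δ'`
and separation `M` (`M ε_N < 1/2`), `E_{P_N}[φ(xᵢ) φ(xⱼ)] ≤ 1 + 16 δ' + 5 Φ_b v₁ (M ε_N)³`
(`BlockDensityLLNConst.integral_mul_apply_le`). [cite: Ruelle1969, §4.2.3 Thm 4.2.3] -/
theorem blockDensity_pairExpectation_le : ∀ σ : ℝ, Literature.MathematicalPhysics.KineticTheory.SmallDensity Literature.MathematicalPhysics.KineticTheory.uniformProfile σ → ∀ (N : ℕ) (i j : Fin (N + 1)), i ≠ j → ∀ φ : T3 → ℝ, Continuous φ → (∀ y, 0 ≤ φ y) → ∀ Φb : ℝ, (∀ y, φ y ≤ Φb) → ∫ y, φ y = 1 → ∀ M δ' : ℝ, 0 ≤ M → 0 ≤ δ' → M * Literature.MathematicalPhysics.KineticTheory.hsDiameter σ N < 1 / 2 → (∀ (k k' : ℕ) (Y : Fin k → T3) (Y' : Fin k' → T3) (c c' : T3), (∀ a, Literature.Analysis.FluidPDE.Torus.euclidDist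 (Y a) c < 1 * Literature.MathematicalPhysics.KineticTheory.hsDiameter σ N) → (∀ a, Literature.Analysis.FluidPDE.Torus.euclidDist (Y' a) c' < 1 * Literature.MathematicalPhysics.KineticTheory.hsDiameter σ N) → M * Literature.MathematicalPhysics.KineticTheory.hsDiameter σ N ≤ Literature.Analysis.FluidPDE.Torus.euclidDist c c' → |Literature.MathematicalPhysics.KineticTheory.vcan (Literature.MathematicalPhysics.KineticTheory.hsDiameter σ N) (N + 1) (Fin.append Y Y') - Literature.MathematicalPhysics.KineticTheory.vcan (Literature.MathematicalPhysics.KineticTheory.hsDiameter σ N) (N + 1) Y * Literature.MathematicalPhysics.KineticTheory.vcan (Literature.MathematicalPhysics.KineticTheory.hsDiameter σ N) (N + 1) Y'| ≤ δ' * 4 ^ (k + k')) → ∫ x, φ (x i) * φ (x j) ∂Literature.MathematicalPhysics.KineticTheory.posGibbsMeasure (fun _ : T3 => (1 : ℝ)) (Literature.MathematicalPhysics.KineticTheory.hsDiameter σ N) (N + 1) ≤ 1 + 16 * δ' + 5 * Φb * (Literature.MathematicalPhysics.KineticTheory.v₁ * (M * Literature.MathematicalPhysics.KineticTheory.hsDiameter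 σ N) ^ 3) :=
  fun _ h N _ _ hij _ hφ hφ0 _ hφb hφ1 _ _ hM hδ' hMε hAN =>
    BlockDensityLLNConst.integral_mul_apply_le h N hij hφ hφ0 hφb hφ1 hM hδ' hMε hAN

end

end Summit.AtomisticToContinuum.HydrodynamicLimit.Theorems.HemisphereAffineSlaving
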